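import Summits.BirchSwinnertonDyer.Rank1Residual.P2.CongruentNumberPrimeFiveModEightMonskyDescent
import Literature.NumberTheory.EllipticCurves.Tian2014.CMPointSystemDescentOneFive
import HarnessLib

/-!
# Cell «bsd-monsky» (prover-A, g14): ROUTE A ON `N = p₁p₅` WITH `(p₁/p₅) = −1` (Monsky's Cor. 5.15 (3), first family;
# Tian's Thm. 4.1 at `k = 1`) from Tian's printed `n ≡ 1 (mod 4)` CM-point system plus Tian's printed divisibility sentence:
# rank `E_{p₀p₁}(ℚ) = 1`, `p₀p₁` congruent, `Ш(E_{p₀p₁})[2^∞] = 0`, odd index of `y_{p₀p₁}`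

HONEST FRAMING (cell `bsd-monsky`, run/shared/lean/pub/bsd-monsky/, README §1: ONE theorem on ONE explicit infinite
family at the prime `2`; nothing booked). This file asserts NO arithmetic fact and claims NOTHING new on paper: that
`p₁p₅` is a congruent number when `(p₁/p₅) = −1` is Monsky 1990 Thm. 3.9 (5) / Cor. 5.15 (3) and Tian 2014 Thm. 4.1 at
`k = 1`. It records the consequences of the transplant `Tian2014/CMPointSystemDescentOneFive.lean` from the PRINTED BINDER
`hSk₁₅ : ∀ p₀ ≡ 5, p₁ ≡ 1 (8) primes with (p₁/p₀) = −1, ∃ D : CMPointDataOne (p₀p₁), D.Printed ∧ ∃ θ₀ = √p₀, θ₁ = √p₁ ∈ H,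
  conj θ₀ = θ₀ ∧ conj θ₁ = θ₁ ∧ (∀ s, σ_s fixes θ₀ and θ₁ ↔ s ∈ 2𝒜) ∧ σ_ϖ θ₀ = −θ₀ ∧ σ_ϖ θ₁ = θ₁ ∧ i ∉ H ∧
  y_{p₀} ∈ 2E(ℚ(√p₀))⁻ + E[2]` —
Tian 2014 Thm. 2.4 (2)–(3), Def. 2.3, the generation sentence and the order of `[ϖ]` (the displays of
`CMPointSystemOneModFour`), the §4.1 genus sentences ("`2𝒜 ≅ Gal(H/H₀)`", "`σ_ϖ(√p₀) = −√p₀` and `σ_ϖ√p_i = √p_i`", the real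
square roots fixed by complex conjugation), "`i ∉ H`", and the ONE ANALYTIC sentence of Tian's induction step, "by induction
hypothesis and Theorem 3.3, we know that `y_d ∈ 2^k E(ℚ(√d))⁻ + E[2]`" (p0021 L68–L70; Thm. 3.3 = Kolyvagin + the
generalised Gross–Zagier formula + `2`-adic valuations of special `L`-values) — binder form, no new named fact; no `2`-Selmer
display, no genus display. "`#(2𝒜)` odd" (Tian's (1.1) at `k = 1`, the graph condition) and "`#𝒜[2] = 4`" are KERNEL
THEOREMS of Rédei–Reichardt + Gauss in the tree:
* (M-y) a RATIONAL point `y″ ∈ E_{p₀p₁}(ℚ)` with `transfer_{√n} y″ = y_{p₀p₁}` (Lemma 4.3 (1)) and `y″ ∉ 2E_{p₀p₁}(ℚ) + tor`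
  (`Tian2014.CMPointDataOne.exists_transferAlong_eq_yTrace_mul_not_two_smul_add_torsion_two_primes`);
* rank `E_{p₀p₁}(ℚ) = 1` (`y″` non-torsion; `≤ 1` = «`S̄ = ℤ/2`» on the Cor. 5.15 family `p₁p₅`, the tree's exact count
  `#Sel₂ = 8`, p528474); `p₀p₁` is a congruent number; `Ш(E_{p₀p₁})[2^∞] = 0`; `y″` has ODD INDEX against every generator.
In the tree this family was reached through Li–Liu–Tian 2024 Thm. 1.2 (full BSD relative to hLLT,
`LiLiuTian2024/CongruentNumberRedeiFamilies`) and TYZ's criterion (DOOR A); this is the transplant of Tian's own induction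
step, with its analytic input displayed as the printed sentence it is. Nothing is asserted unconditionally beyond the tree's
own descent theorems.
[cite: Tian2014, Thm. 4.1 (arXiv:1210.8231 p0019 L65–L70) and its proof (p0021 L49–p0022 L20), Thm. 3.3 (p0014 L99–L105)]
[cite: Monsky1990MockHeegner, Thm. 3.9 (5) (p. 55), Cor. 5.15 (3) (p. 66), Remark (2) (p. 67)]
[cite: SilvermanAEC2009, Thm. X.4.2] [cite: TopYui2008Congruent, Prop. 3.3 (i) ⟺ (iv)]
-/

noncomputable section

open scoped Classical NumberTheorySymbols

open WeierstrassCurve NumberField Literature.NumberTheory.EllipticCurves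
  Literature.NumberTheory.EllipticCurves.Rank1Residual
  Literature.NumberTheory.EllipticCurves.Rank1Residual.Typed
  Literature.NumberTheory.EllipticCurves.Monsky1990
  Literature.NumberTheory.EllipticCurves.TianYuanZhang2017

set_option autoImplicit false

namespace Summit.BirchSwinnertonDyer.Rank1Residual.P2

open Conjectures Literature.NumberTheory.EllipticCurves.Tian2014

/-! ## §1 The family `p₁p₅` with `(p₁/p₅) = −1` is a Cor. 5.15 family -/

/-- **`p₀p₁` with `p₀ ≡ 5`, `p₁ ≡ 1 (8)` primes and `(p₁/p₀) = −1` is Monsky's family `p₁p₅` of Cor. 5.15 (3)**.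
[cite: Monsky1990MockHeegner, Cor. 5.15 (3) (p. 66)] -/
theorem isCor515Family_one_five {p₀ p₁ : ℕ} (hp₀ : p₀.Prime) (hp₁ : p₁.Prime) (h₀5 : p₀ % 8 = 5)
    (h₁1 : p₁ % 8 = 1) (hj : jacobiSym (p₁ : ℤ) p₀ = -1) : IsCor515Family (p₀ * p₁) :=
  Or.inr (Or.inr (Or.inr (Or.inr (Or.inl ⟨p₁, p₀, hp₁, hp₀, h₁1, Or.inl h₀5, hj, mul_comm p₀ p₁⟩))))

/-! ## §2 The printed binder and the consequences -/

/-- **Rank `E_{p₀p₁}(ℚ) = 1` on the family `p₁p₅`, `(p₁/p₅) = −1`, from the printed binder** (Tian Thm. 4.1 at `k = 1`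
transplanted: `y_{p₀p₁}` is the transfer of a rational point `y″ ∉ 2E + tor`, so `rank ≥ 1`; `rank ≤ 1` is the tree's exact
count `#Sel₂ = 8` on the Cor. 5.15 family). The analytic input is the displayed sentence `hDiv` inside the binder.
[cite: Tian2014, Thm. 4.1 (p0019 L65–L70)] [cite: Monsky1990MockHeegner, Thm. 3.9 (5) (p. 55), Cor. 5.15 (3) (p. 66)]
[cite: SilvermanAEC2009, Thm. X.4.2] -/
theorem mordellWeilRank_eq_one_one_five_of_printed
    (hSk₁₅ : ∀ p₀ p₁ : ℕ, (hp₀ : p₀.Prime) → p₁.Prime → p₀ % 8 = 5 → p₁ % 8 = 1 → jacobiSym (p₁ : ℤ) p₀ = -1 →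
      ∃ D : CMPointDataOne (p₀ * p₁), D.Printed ∧
        ∃ (θ₀ : D.H) (hθ₀ : θ₀ ^ 2 = (p₀ : D.H)) (θ₁ : D.H), θ₁ ^ 2 = (p₁ : D.H) ∧
          D.conj θ₀ = θ₀ ∧ D.conj θ₁ = θ₁ ∧ (∀ s, (D.art s θ₀ = θ₀ ∧ D.art s θ₁ = θ₁) ↔ IsSquare s) ∧
          D.art D.piClass θ₀ = -θ₀ ∧ D.art D.piClass θ₁ = θ₁ ∧ (∀ x : D.H, x ^ 2 ≠ -1) ∧
          ∃ (w : (congruentNumberCurve p₀).toAffine.Point) (T' : EPoint D.H), (2 : ℕ) • T' = 0 ∧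
            D.yTrace θ₀ = D.transferAlong p₀ hp₀.ne_zero hθ₀ ((2 : ℕ) • w) + T') :
    ∀ p₀ p₁ : ℕ, p₀.Prime → p₁.Prime → p₀ % 8 = 5 → p₁ % 8 = 1 → jacobiSym (p₁ : ℤ) p₀ = -1 →
      (congruentNumberCurve (p₀ * p₁)).mordellWeilRank = 1 := by
  intro p₀ p₁ hp₀ hp₁ h₀5 h₁1 hj
  have hN : IsCor515Family (p₀ * p₁) := isCor515Family_one_five hp₀ hp₁ h₀5 h₁1 hj
  haveI := isElliptic_congruentNumberCurve hN.ne_zero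
  obtain ⟨D, hP, θ₀, hθ₀, θ₁, hθ₁, hconj₀, hconj₁, hgen, hπ₀, hπ₁, hnoI, hDiv⟩ := hSk₁₅ p₀ p₁ hp₀ hp₁ h₀5 h₁1 hj
  obtain ⟨y'', -, hnot⟩ := D.exists_transferAlong_eq_yTrace_mul_not_two_smul_add_torsion_two_primes rfl hp₀ hp₁
    h₀5 h₁1 hj hP hθ₀ hθ₁ hconj₀ hconj₁ hgen hπ₀ hπ₁ hnoI hDiv
  exact le_antisymm (mordellWeilRank_le_one_of_isCor515Family hN)
    (Nat.one_le_iff_ne_zero.mpr (mordellWeilRank_ne_zero_of_not_two_smul_add_torsion hN.ne_zero y'' hnot))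

/-- **`p₀p₁` is a congruent number on the family `p₁p₅`, `(p₁/p₅) = −1`, from the printed binder** (Cor. 5.15 (3)).
[cite: Tian2014, Thm. 4.1 (p0019 L65–L70)] [cite: Monsky1990MockHeegner, Cor. 5.15 (3) (p. 66)]
[cite: TopYui2008Congruent, Prop. 3.3 (i) ⟺ (iv)] -/
theorem isCongruentNumber_one_five_of_printed
    (hSk₁₅ : ∀ p₀ p₁ : ℕ, (hp₀ : p₀.Prime) → p₁.Prime → p₀ % 8 = 5 → p₁ % 8 = 1 → jacobiSym (p₁ : ℤ) p₀ = -1 →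
      ∃ D : CMPointDataOne (p₀ * p₁), D.Printed ∧
        ∃ (θ₀ : D.H) (hθ₀ : θ₀ ^ 2 = (p₀ : D.H)) (θ₁ : D.H), θ₁ ^ 2 = (p₁ : D.H) ∧
          D.conj θ₀ = θ₀ ∧ D.conj θ₁ = θ₁ ∧ (∀ s, (D.art s θ₀ = θ₀ ∧ D.art s θ₁ = θ₁) ↔ IsSquare s) ∧
          D.art D.piClass θ₀ = -θ₀ ∧ D.art D.piClass θ₁ = θ₁ ∧ (∀ x : D.H, x ^ 2 ≠ -1) ∧
          ∃ (w : (congruentNumberCurve p₀).toAffine.Point) (T' : EPoint D.H), (2 : ℕ) • T' = 0 ∧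
            D.yTrace θ₀ = D.transferAlong p₀ hp₀.ne_zero hθ₀ ((2 : ℕ) • w) + T') :
    ∀ p₀ p₁ : ℕ, p₀.Prime → p₁.Prime → p₀ % 8 = 5 → p₁ % 8 = 1 → jacobiSym (p₁ : ℤ) p₀ = -1 →
      IsCongruentNumber (p₀ * p₁) :=
  fun p₀ p₁ hp₀ hp₁ h₀5 h₁1 hj =>
    (Wiles2000.mordellWeilRank_ne_zero_iff_isCongruentNumber (by have := hp₀.pos; have := hp₁.pos; nlinarith)).mp
      (by rw [mordellWeilRank_eq_one_one_five_of_printed hSk₁₅ p₀ p₁ hp₀ hp₁ h₀5 h₁1 hj]; exact one_ne_zero)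

/-- **`Ш(E_{p₀p₁})[2^∞] = 0` on the family `p₁p₅`, `(p₁/p₅) = −1`, from the printed binder** (rank one and the exact count
`#Sel₂ = 8`). [cite: Monsky1990MockHeegner, Remark (2) (p. 67)] [cite: SilvermanAEC2009, Thm. X.4.2] -/
theorem primaryComponent_sha_two_eq_bot_one_five_of_printed
    (hSk₁₅ : ∀ p₀ p₁ : ℕ, (hp₀ : p₀.Prime) → p₁.Prime → p₀ % 8 = 5 → p₁ % 8 = 1 → jacobiSym (p₁ : ℤ) p₀ = -1 →
      ∃ D : CMPointDataOne (p₀ * p₁), D.Printed ∧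
        ∃ (θ₀ : D.H) (hθ₀ : θ₀ ^ 2 = (p₀ : D.H)) (θ₁ : D.H), θ₁ ^ 2 = (p₁ : D.H) ∧
          D.conj θ₀ = θ₀ ∧ D.conj θ₁ = θ₁ ∧ (∀ s, (D.art s θ₀ = θ₀ ∧ D.art s θ₁ = θ₁) ↔ IsSquare s) ∧
          D.art D.piClass θ₀ = -θ₀ ∧ D.art D.piClass θ₁ = θ₁ ∧ (∀ x : D.H, x ^ 2 ≠ -1) ∧
          ∃ (w : (congruentNumberCurve p₀).toAffine.Point) (T' : EPoint D.H), (2 : ℕ) • T' = 0 ∧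
            D.yTrace θ₀ = D.transferAlong p₀ hp₀.ne_zero hθ₀ ((2 : ℕ) • w) + T') :
    ∀ p₀ p₁ : ℕ, (hp₀ : p₀.Prime) → (hp₁ : p₁.Prime) → p₀ % 8 = 5 → p₁ % 8 = 1 → jacobiSym (p₁ : ℤ) p₀ = -1 →
      haveI := isElliptic_congruentNumberCurve (n := p₀ * p₁) (Nat.mul_ne_zero hp₀.ne_zero hp₁.ne_zero)
      AddCommGroup.primaryComponent (congruentNumberCurve (p₀ * p₁)).sha 2 = ⊥ := by
  intro p₀ p₁ hp₀ hp₁ h₀5 h₁1 hj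
  have hN : IsCor515Family (p₀ * p₁) := isCor515Family_one_five hp₀ hp₁ h₀5 h₁1 hj
  have h := (isCongruentNumber_iff_primaryComponent_sha_two_eq_bot_of_isCor515Family hN).mp
    (isCongruentNumber_one_five_of_printed hSk₁₅ p₀ p₁ hp₀ hp₁ h₀5 h₁1 hj)
  convert h

/-- **MONSKY'S THEOREM 3.9 (5) / TIAN'S THEOREM 4.1 AT `k = 1` FOR TIAN'S POINT `y_{p₀p₁}`, from the printed binder**: for
every such pair there are a printed system `D`, the square roots with the §4.1 sentences, `i ∉ H`, the divisibility
sentence for `y_{p₀}`, and a rational point `y″ ∈ E_{p₀p₁}(ℚ)` with `transfer_{√n} y″ = y_{p₀p₁}`, of INFINITE ORDER and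
ODD INDEX against every generator of `E_{p₀p₁}(ℚ)/tor` ("`y_n ∉ 2E(ℚ(√n))⁻ + E[2]`"). No `2`-Selmer display, no genus
display, no reading mark; the one analytic sentence is displayed as printed.
[cite: Tian2014, Thm. 4.1 (p0019 L65–L70)] [cite: Monsky1990MockHeegner, Thm. 3.9 (5) (p. 55)] -/
theorem monskyOddIndex_one_five_of_printed
    (hSk₁₅ : ∀ p₀ p₁ : ℕ, (hp₀ : p₀.Prime) → p₁.Prime → p₀ % 8 = 5 → p₁ % 8 = 1 → jacobiSym (p₁ : ℤ) p₀ = -1 →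
      ∃ D : CMPointDataOne (p₀ * p₁), D.Printed ∧
        ∃ (θ₀ : D.H) (hθ₀ : θ₀ ^ 2 = (p₀ : D.H)) (θ₁ : D.H), θ₁ ^ 2 = (p₁ : D.H) ∧
          D.conj θ₀ = θ₀ ∧ D.conj θ₁ = θ₁ ∧ (∀ s, (D.art s θ₀ = θ₀ ∧ D.art s θ₁ = θ₁) ↔ IsSquare s) ∧
          D.art D.piClass θ₀ = -θ₀ ∧ D.art D.piClass θ₁ = θ₁ ∧ (∀ x : D.H, x ^ 2 ≠ -1) ∧
          ∃ (w : (congruentNumberCurve p₀).toAffine.Point) (T' : EPoint D.H), (2 : ℕ) • T' = 0 ∧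
            D.yTrace θ₀ = D.transferAlong p₀ hp₀.ne_zero hθ₀ ((2 : ℕ) • w) + T') :
    ∀ p₀ p₁ : ℕ, (hp₀ : p₀.Prime) → (hp₁ : p₁.Prime) → p₀ % 8 = 5 → p₁ % 8 = 1 → jacobiSym (p₁ : ℤ) p₀ = -1 →
      ∃ D : CMPointDataOne (p₀ * p₁), D.Printed ∧
        ∃ (θ₀ : D.H) (hθ₀ : θ₀ ^ 2 = (p₀ : D.H)) (θ₁ : D.H) (hθ₁ : θ₁ ^ 2 = (p₁ : D.H)),
          ∃ y'' : (congruentNumberCurve (p₀ * p₁)).toAffine.Point,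
            D.transferAlong (p₀ * p₁) (Nat.mul_ne_zero hp₀.ne_zero hp₁.ne_zero)
              (D.mul_sq_eq_natCast_of_eq rfl hθ₀ hθ₁) y'' = D.yTrace (θ₀ * θ₁) ∧ ¬ IsOfFinAddOrder y'' ∧
            (∀ g : (congruentNumberCurve (p₀ * p₁)).toAffine.Point, GeneratesFreePartRat (p₀ * p₁) g →
              ∃ m : ℤ, Odd m ∧ IsOfFinAddOrder (y'' - m • g)) := by
  intro p₀ p₁ hp₀ hp₁ h₀5 h₁1 hj
  obtain ⟨D, hP, θ₀, hθ₀, θ₁, hθ₁, hconj₀, hconj₁, hgen, hπ₀, hπ₁, hnoI, hDiv⟩ := hSk₁₅ p₀ p₁ hp₀ hp₁ h₀5 h₁1 hj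
  obtain ⟨y'', hy'', hnot⟩ := D.exists_transferAlong_eq_yTrace_mul_not_two_smul_add_torsion_two_primes rfl hp₀ hp₁
    h₀5 h₁1 hj hP hθ₀ hθ₁ hconj₀ hconj₁ hgen hπ₀ hπ₁ hnoI hDiv
  exact ⟨D, hP, θ₀, hθ₀, θ₁, hθ₁, y'', hy'', not_isOfFinAddOrder_of_not_two_smul_add_torsion y'' hnot,
    fun g hg => exists_odd_isOfFinAddOrder_sub_zsmul_of_not_two_smul_add_torsion y'' hnot g hg⟩

end Summit.BirchSwinnertonDyer.Rank1Residual.P2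

end
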